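import Literature.AnabelianGeometry.SemiGraphs.OverStarSectionRigidity
import Literature.AnabelianGeometry.SemiGraphs.PullbackFunctorExact
import Mathlib.CategoryTheory.Limits.Preserves.Shapes.Terminal
import HarnessLib

/-!
# The local and the global witness of a finite étale covering differ by base change along a section
# ([SemiAnbd] Def. 2.2 (i), p. 23; Rem. 2.2.1, p. 24)

Mochizuki, *Semi-graphs of anabelioids*, Publ. RIMS **42** (2006), §2, Def. 2.2 (i) p. 23 and
Rem. 2.2.1 p. 24 [cite: MochizukiSemiAnbd2006, Def. 2.2(i) p.23]: the covering `ℋ → 𝒦` attached to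
`A ∈ B(𝒦)` is described GLOBALLY ("`B(ℋ) = B(𝒦)_{/A}`") and LOCALLY ("`ℋ_w` is the anabelioid
`(𝒦_u)_P`" of a connected component `P` of `A_u`).  In the cell these are INDEPENDENT witnesses
(`Hom.IsGlobalCoveringOf`: `αψ : B(𝒦)_{/A} ⥲ B(ℋ)` with `ψ^* ≅ (A × −) ⋙ αψ`; the local clause of
`Hom.IsFiniteEtaleCoveringOf`: `α_w : (𝒦_u)_{/P} ⥲ ℋ_w` with `ψ_w^* ≅ (P × −) ⋙ α_w`).

PROOF + two small DEFINITIONS (abc-iut cell, layer L3, F-1478 residual «print's finite étale coverings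
compose», brick (L-C) «global↔local comparison» of the LOCAL clause of a composite; seat
abc-iut-w5-d041; memo `HOME/staging/w5/w5-d041-g3/L-LOCAL-CLAUSE-DECOMPOSITION.md` §2).  For such a pair
of witnesses at a vertex `w ↦ u`:

* `Hom.localGlobalFunctor` — the comparison functor `K_w := αψ ⋙ ρ_w ⋙ α_w⁻¹ : B(𝒦)_{/A} ⥤ (𝒦_u)_{/P}`
  and `Hom.localGlobalIso` — `(A × −) ⋙ K_w ≅ ρ_u ⋙ (P × −)` (from the two compatibilities and
  `ψ^* ⋙ ρ_w = ρ_u ⋙ ψ_w^*`);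
* `Hom.localGlobalSection` — the SECTION MAP `σ_w : P ⟶ A_u` ("where the global witness places the
  vertex `w`", the tautological point of `A` over its own covering read at `w` through `α_w`);
* `Hom.exists_iso_localGlobal_pullback` — **`K_w` is objectwise base change along `σ_w`**
  (`OverStarSectionRigidity`): `α_w⁻¹((αψ Y)_w) ≅ P ×_{σ_w, A_u} Y_u` over `P` for every `Y ∈ B(𝒦)_{/A}`;
  `Hom.exists_iso_localGlobal_pullback_obj` — for every `B ∈ B(ℋ)`:
  `(α_w⁻¹ B_w) ≅ P ×_{σ_w, A_u} C_u` over `P`, `C := (αψ⁻¹ B).left` (the object of the composite's global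
  clause, abc-iut-f-161 `IsGlobalCoveringOf.comp`).

So the composite's vertex constituents are star-shaped over SUB-objects of `C_u` exactly when `σ_w` is
a monomorphism — the residual (L-σ) of the memo, to be supplied by `Hom.IsVertexAligned`.  Nothing here
bears on [IUTchIII] Cor. 3.12; no `Prop` is asserted.
-/

namespace Literature.AnabelianGeometry.SemiGraphs

namespace SemiGraphOfAnabelioids

open CategoryTheory CategoryTheory.Limits

universe v₁ u₁ u

variable {ℋ 𝒦 : SemiGraphOfAnabelioids.{v₁, u₁, u}} (ψ : Hom ℋ 𝒦) (A : 𝒦.BObj)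
  (αψ : Over A ⥤ ℋ.BObj) [αψ.IsEquivalence] (w : ℋ.graph.Vertex)
  (P : 𝒦.V (ψ.base.vertexMap w)) (αw : Over P ⥤ ℋ.V w) [αw.IsEquivalence]

/-- The GLOBAL↔LOCAL comparison functor at `w`: `K_w := αψ ⋙ ρ_w ⋙ α_w⁻¹ : B(𝒦)_{/A} ⥤ (𝒦_u)_{/P}`.
[cite: MochizukiSemiAnbd2006, Def. 2.2(i) p.23] -/
noncomputable def Hom.localGlobalFunctor : Over A ⥤ Over P := αψ ⋙ ℋ.ρ w ⋙ αw.inv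

/-- `K_w` preserves equalizers (equivalences do; `ρ_w` does, limits in `B(ℋ)` being componentwise).
[cite: MochizukiSemiAnbd2006, Def. 2.2(i) p.23] -/
theorem Hom.localGlobalFunctor_preservesLimitsOfShape_walkingParallelPair :
    PreservesLimitsOfShape WalkingParallelPair (Hom.localGlobalFunctor ψ A αψ w P αw) := by
  obtain ⟨-, hρ, -⟩ := ℋ.hasLimitsOfShape_bObj (J := WalkingParallelPair)
  haveI := hρ w
  dsimp only [Hom.localGlobalFunctor]
  infer_instance

/-- `K_w(𝟙_A)` is terminal (equivalences and `ρ_w` preserve the terminal object).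
[cite: MochizukiSemiAnbd2006, Def. 2.2(i) p.23] -/
noncomputable def Hom.localGlobalFunctor_isTerminal :
    IsTerminal ((Hom.localGlobalFunctor ψ A αψ w P αw).obj (Over.mk (𝟙 A))) := by
  obtain ⟨-, hρ, -⟩ := ℋ.hasLimitsOfShape_bObj (J := Discrete PEmpty.{1})
  haveI := hρ w
  haveI : PreservesLimitsOfShape (Discrete PEmpty.{1}) (Hom.localGlobalFunctor ψ A αψ w P αw) := by
    dsimp only [Hom.localGlobalFunctor]; infer_instance
  exact Over.mkIdTerminal.isTerminalObj (Hom.localGlobalFunctor ψ A αψ w P αw) (Over.mk (𝟙 A))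

variable [HasBinaryProducts 𝒦.BObj] (eψ : ψ.pullbackFunctor ≅ Over.star A ⋙ αψ)
  (ew : (ψ.φV w).pullback ≅ Over.star P ⋙ αw)

/-- `(A × −) ⋙ K_w ≅ ρ_u ⋙ (P × −)`: the global compatibility `ψ^* ≅ (A × −) ⋙ αψ`, the identity
`ψ^* ⋙ ρ_w = ρ_u ⋙ ψ_w^*` (`pullbackFunctor_comp_ρ`), the local compatibility `ψ_w^* ≅ (P × −) ⋙ α_w`
and `α_w ⋙ α_w⁻¹ ≅ 𝟭`. [cite: MochizukiSemiAnbd2006, Def. 2.2(i) p.23] -/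
noncomputable def Hom.localGlobalIso :
    Over.star A ⋙ Hom.localGlobalFunctor ψ A αψ w P αw ≅
      𝒦.ρ (ψ.base.vertexMap w) ⋙ Over.star P :=
  Functor.isoWhiskerRight eψ.symm (ℋ.ρ w ⋙ αw.inv) ≪≫
    (Functor.isoWhiskerRight (eqToIso (ψ.pullbackFunctor_comp_ρ w)) αw.inv :
      (ψ.pullbackFunctor ⋙ ℋ.ρ w) ⋙ αw.inv ≅
        (𝒦.ρ (ψ.base.vertexMap w) ⋙ (ψ.φV w).pullback) ⋙ αw.inv) ≪≫
    Functor.isoWhiskerLeft (𝒦.ρ (ψ.base.vertexMap w)) (Functor.isoWhiskerRight ew αw.inv) ≪≫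
    Functor.isoWhiskerLeft (𝒦.ρ (ψ.base.vertexMap w) ⋙ Over.star P) αw.asEquivalence.unitIso.symm

/-- The SECTION MAP `σ_w : P ⟶ A_u` of the pair of witnesses at `w`: the section map of `K_w`
(`OverStar.sectionMap`; "where the global witness places `w`").
[cite: MochizukiSemiAnbd2006, Rem. 2.2.1 p.24] -/
noncomputable def Hom.localGlobalSection : P ⟶ A.S (ψ.base.vertexMap w) :=
  OverStar.sectionMap (Over.forgetAdjStar A) (Over.forgetAdjStar P) (Hom.localGlobalFunctor ψ A αψ w P αw)
    (𝒦.ρ (ψ.base.vertexMap w)) (Hom.localGlobalIso ψ A αψ w P αw eψ ew)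
    (Hom.localGlobalFunctor_isTerminal ψ A αψ w P αw)

/-- **Global↔local comparison** ([SemiAnbd] Def. 2.2 (i) / Rem. 2.2.1): for every `Y ∈ B(𝒦)_{/A}`, the
local reading `α_w⁻¹((αψ Y)_w)` of the global object `αψ Y` is the base change `P ×_{σ_w, A_u} Y_u` over
`P`, compatibly with the structure maps (in the vocabulary of `OverStarSectionRigidity`).
[cite: MochizukiSemiAnbd2006, Def. 2.2(i) p.23] -/
theorem Hom.exists_iso_localGlobal_pullback (Y : Over A) :
    ∃ e : (Hom.localGlobalFunctor ψ A αψ w P αw).obj Y ≅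
        OverStar.pullbackObj (Hom.localGlobalSection ψ A αψ w P αw eψ ew) (Y.hom.fS (ψ.base.vertexMap w)),
      e.hom ≫ OverStar.pullbackι (Over.forgetAdjStar P) (Hom.localGlobalSection ψ A αψ w P αw eψ ew)
          (Y.hom.fS (ψ.base.vertexMap w)) =
        (Hom.localGlobalFunctor ψ A αψ w P αw).map (OverStar.unit' (Over.forgetAdjStar A) Y) ≫
          OverStar.ιHom (Hom.localGlobalFunctor ψ A αψ w P αw) (𝒦.ρ (ψ.base.vertexMap w))
            (Hom.localGlobalIso ψ A αψ w P αw eψ ew) Y.left := by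
  haveI := Hom.localGlobalFunctor_preservesLimitsOfShape_walkingParallelPair ψ A αψ w P αw
  exact OverStar.exists_iso_pullback (Over.forgetAdjStar A) (Over.forgetAdjStar P)
    (Hom.localGlobalFunctor ψ A αψ w P αw) (𝒦.ρ (ψ.base.vertexMap w))
    (Hom.localGlobalIso ψ A αψ w P αw eψ ew) (Hom.localGlobalFunctor_isTerminal ψ A αψ w P αw) Y

/-- **The local reading of a global object is a base change along `σ_w`**: for every `B ∈ B(ℋ)`,
`α_w⁻¹(B_w) ≅ P ×_{σ_w, A_u} C_u` over `P`, where `C := (αψ⁻¹ B).left ∈ B(𝒦)` is the object of the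
composite's global clause (abc-iut-f-161's `IsGlobalCoveringOf.comp`).  In particular `α_w⁻¹(B_w).left`
is a SUB-object of `C_u` as soon as `σ_w` is a monomorphism. [cite: MochizukiSemiAnbd2006, Def. 2.2(i) p.23] -/
theorem Hom.exists_iso_localGlobal_pullback_obj (B : ℋ.BObj) :
    Nonempty (αw.inv.obj (B.S w) ≅
        OverStar.pullbackObj (Hom.localGlobalSection ψ A αψ w P αw eψ ew)
          ((αψ.inv.obj B).hom.fS (ψ.base.vertexMap w))) := by
  obtain ⟨e, -⟩ := Hom.exists_iso_localGlobal_pullback ψ A αψ w P αw eψ ew (αψ.inv.obj B)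
  exact ⟨((ℋ.ρ w ⋙ αw.inv).mapIso (αψ.asEquivalence.counitIso.app B)).symm ≪≫ e⟩

end SemiGraphOfAnabelioids

end Literature.AnabelianGeometry.SemiGraphs
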